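import Literature.NumberTheory.EllipticCurves.KatoFineSelmerDual
import Literature.NumberTheory.EllipticCurves.SelmerInftyTorsionFiniteProofs
import Literature.NumberTheory.EllipticCurves.IwasawaSelmerProofs
import Literature.NumberTheory.EllipticCurves.PointDivisibilityProofs
import Literature.NumberTheory.GaloisRepresentations.ContinuousCorestriction
import HarnessLib

/-!
# K6 crux `MuTransferX9` (stmt-BirchSwinnertonDyer-19276), stub `stub_selmerDualOdd` (skeleton v6),
# local condition at `p`, part 1: the fine condition at the place above `p`, read on the decomposition group

Cell `bsd-smallim`, seat `bsd-smallim-k6-c2` (gen 3). HONEST FRAMING: theorems only (no definition, no named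
fact, no `sorry`); nothing is asserted about any curve and nothing is booked. Toward hypothesis (L-p) of
`SelmerDual.stub_selmerDualOdd_of_local` (`…X9SelmerDualAssembly.lean`), architecture (Lp-4) of the seat's
NOTES: the FINE Selmer condition of a class `y ∈ H¹(K_∞, E[p])` at the place above `p` in the currency of
the decomposition group `D_v = GreenbergSelmer.decomp v ≤ Γ_K` and its subgroups
`decompIn H v = (H ⊓ D_v) ⊆ D_v` (`GreenbergSelmer`), for an elliptic curve over a number field `K`:

* `decompIn_normal` — `decompIn H v` is normal in `D_v` for `H` normal in `Γ_K` (so `D_v` acts on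
  `H¹(decompIn H v, M)` by the tree's `conjH1`).
* `resH1Hom_decompInToH_eq_zero_of_mem_fineSelmerInfty` — **`y` fine ⟹ `res_{D_v ∩ Gal(K̄/K_∞)} ι(y) = 0`**
  in `H¹(D_v ∩ Gal(K̄/K_∞), E[p^∞])`: the strict condition at `v ∣ p` for the fine datum `M⁺_v = 0`
  (`fineLocalDatum`, `strictKer`), whose coefficient map `M → M ⧸ 0` is injective on `H¹`
  (`resH1Hom_grMk_injective`).
* `resH1Hom_decompInToH_torsionToPrimaryH1Sub` — restriction to `decompIn H v` commutes with
  `E[p] ↪ E[p^∞]` on `H¹`; hence (`resH1Hom_decompInToH_mem_ker_of_mem_fineSelmerInfty`) **the restriction of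
  a fine `y ∈ H¹(K_∞, E[p])` to `D_v ∩ Gal(K̄/K_∞)` lies in the Kummer kernel
  `B₁ = ker(H¹(·, E[p]) → H¹(·, E[p^∞]))`** of that group.
* `finite_ker_localTorsionToPrimary` — **`B₁` is finite** (transport of the tree's
  `finite_ker_torsionToPrimaryH1Sub` for the subgroup `Gal(K̄/K_∞) ⊓ D_v ≤ Γ_K` along the tautological
  isomorphism `decompIn H v ≅ H ⊓ D_v`; `resH1Hom_subgroupOfHom_injective`).

PARTITION (D-0054): X9 (A4) × p ∈ {5,7} (+ X10b∧¬Surj at 3) — helper toward `stub_selmerDualOdd`; closes none.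

References: R. Greenberg, *Iwasawa theory for p-adic representations* (1989) §1 p. 98 [Greenberg1989];
R. Greenberg, LNM 1716 (1999) §3 Lemma 3.1 [GreenbergLNM1716]; HOME/koly/MU-TRANSFER-PROOF.md §5 STEP 1.
-/

set_option linter.dupNamespace false
set_option autoImplicit false

noncomputable section

open scoped NumberField
open Field IsDedekindDomain
open WeierstrassCurve (geomTorsion geomPrimaryTorsion geomTorsion_le_geomPrimaryTorsion)
open Literature.NumberTheory.GaloisRepresentations
open Literature.NumberTheory.EllipticCurves
open Literature.NumberTheory.EllipticCurves.GreenbergSelmer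

universe u

namespace Summit.BirchSwinnertonDyer.BirchSwinnertonDyer.Rank1Residual.SelmerDual

/-! ## `decompIn H v` is normal in `D_v` -/

section Normal

variable {K : Type u} [Field K] [NumberField K]

/-- `decompIn H v = H ⊓ D_v` is a normal subgroup of `D_v` when `H ⊴ Γ_K`. [cite: Greenberg1989, §1 p. 98] -/
theorem decompIn_normal (H : Subgroup (absoluteGaloisGroup K)) [hH : H.Normal]
    (v : HeightOneSpectrum (𝓞 K)) : (decompIn H v).Normal :=
  ⟨fun x hx g => by
    rw [mem_decompIn_iff] at hx ⊢
    push_cast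
    exact hH.conj_mem _ hx _⟩

end Normal

/-! ## Pull-back along a tautological isomorphism of subgroups is injective on `H¹` -/

section Generic

variable {G : Type u} [Group G] [TopologicalSpace G] [IsTopologicalGroup G]
  {M N : Type u} [AddCommGroup M] [DistribMulAction G M] [TopologicalSpace M] [DiscreteTopology M]
  [AddCommGroup N] [DistribMulAction G N] [TopologicalSpace N] [DiscreteTopology N]

/-- A compatible pair `(φ, ψ)` with `φ` a continuous group ISOMORPHISM and `ψ` the identity induces an
injective map on `H¹` (it has the left inverse induced by `φ⁻¹`). [cite: NeukirchSchmidtWingberg2008, I.§5] -/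
theorem resH1Hom_injective_of_leftInverse {G' : Type u} [Group G'] [TopologicalSpace G']
    [IsTopologicalGroup G'] [DistribMulAction G' M] (φ : G' →ₜ* G) (φ' : G →ₜ* G')
    (hφ : ∀ (x : G') (m : M), (φ x) • m = x • m) (hφ' : ∀ (x : G) (m : M), (φ' x) • m = x • m)
    (hinv : ∀ x : G, φ (φ' x) = x) :
    Function.Injective (resH1Hom φ (AddMonoidHom.id M) (fun x m => hφ x m)) := by
  have hcomp : (resH1Hom φ' (AddMonoidHom.id M) (fun x m => hφ' x m)).comp
      (resH1Hom φ (AddMonoidHom.id M) (fun x m => hφ x m)) = AddMonoidHom.id _ := by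
    rw [resH1Hom_comp]
    have hφφ' : φ.comp φ' = ContinuousMonoidHom.id G := ContinuousMonoidHom.ext hinv
    rw [resH1Hom_congr hφφ' (show (AddMonoidHom.id M).comp (AddMonoidHom.id M) = AddMonoidHom.id M
      from rfl) _ (fun _ _ => rfl)]
    exact resH1Hom_id
  intro a b hab
  have h := congrArg (resH1Hom φ' (AddMonoidHom.id M) (fun x m => hφ' x m)) hab
  rwa [← AddMonoidHom.comp_apply, ← AddMonoidHom.comp_apply, hcomp] at h

/-- For subgroups `H ≤ H'` of `G`, pull-back along the tautological isomorphism
`subgroupOfHom h : H.subgroupOf H' → H` is injective on `H¹(·, M)`. [cite: NeukirchSchmidtWingberg2008, I.§5] -/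
theorem resH1Hom_subgroupOfHom_injective {H H' : Subgroup G} (h : H ≤ H') :
    Function.Injective (resH1Hom (subgroupOfHom h) (AddMonoidHom.id M) (fun _ _ => rfl) :
      subgroupH1 H M →+ subgroupH1 (H.subgroupOf H') M) := by
  let φ' : H →ₜ* H.subgroupOf H' :=
    { toFun := fun x => ⟨⟨(x : G), h x.2⟩, Subgroup.mem_subgroupOf.mpr x.2⟩
      map_one' := rfl
      map_mul' := fun _ _ => rfl
      continuous_toFun := (continuous_subtype_val.subtype_mk _).subtype_mk _ }
  exact resH1Hom_injective_of_leftInverse (subgroupOfHom h) φ' (fun _ _ => rfl) (fun _ _ => rfl)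
    (fun x => Subtype.ext rfl)

end Generic

/-! ## The fine condition at the place above `p`, on the decomposition group -/

section Fine

variable {K : Type u} [Field K] [NumberField K] (W : WeierstrassCurve K) (p : ℕ)
  [Fact p.Prime] (κ : ZpExtension K p) (v : HeightOneSpectrum (𝓞 K))

/-- For the fine datum `M⁺_v = 0` the coefficient map `M → M ⧸ 0` is injective on `H¹(decompIn H v, ·)`
(it has an equivariant inverse). [cite: Greenberg1989, §1 p. 98] -/
theorem resH1Hom_grMk_injective {M : Type u} [AddCommGroup M]
    [DistribMulAction (absoluteGaloisGroup K) M] [TopologicalSpace M] [DiscreteTopology M]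
    (H : Subgroup (absoluteGaloisGroup K)) :
    Function.Injective (resH1Hom (ContinuousMonoidHom.id (decompIn H v)) (fineLocalDatum M v).grMk
      (fun _ _ => rfl) : subgroupH1 (decompIn H v) M →+ discreteH1 (decompIn H v) (fineLocalDatum M v).Gr) := by
  let ψ' : (fineLocalDatum M v).Gr →+ M :=
    QuotientAddGroup.lift (fineLocalDatum M v).plus (AddMonoidHom.id M) (by
      rw [fineLocalDatum_plus]; exact bot_le)
  have hψ' : ∀ m : M, ψ' ((fineLocalDatum M v).grMk m) = m := fun m => rfl
  have heq : ∀ (x : decompIn H v) (q : (fineLocalDatum M v).Gr), ψ' (x • q) = x • ψ' q := fun x q => by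
    obtain ⟨m, rfl⟩ := (fineLocalDatum M v).grMk_surjective q
    rw [hψ', Subgroup.smul_def, LocalDatum.smul_grMk, hψ']
    rfl
  have hcomp : (resH1Hom (ContinuousMonoidHom.id (decompIn H v)) ψ' heq).comp
      (resH1Hom (ContinuousMonoidHom.id (decompIn H v)) (fineLocalDatum M v).grMk (fun _ _ => rfl)) =
      AddMonoidHom.id _ := by
    rw [resH1Hom_comp, resH1Hom_congr rfl (show ψ'.comp (fineLocalDatum M v).grMk = AddMonoidHom.id M
      from AddMonoidHom.ext hψ') _ (fun _ _ => rfl)]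
    exact resH1Hom_id
  intro a b hab
  have h := congrArg (resH1Hom (ContinuousMonoidHom.id (decompIn H v)) ψ' heq) hab
  rwa [← AddMonoidHom.comp_apply, ← AddMonoidHom.comp_apply, hcomp] at h

/-- **A fine class is locally trivial at the place above `p`**: for `c ∈ Sel₀(K_∞, E[p^∞])` and `v ∣ p`,
the restriction of `c` to `decompIn Gal(K̄/K_∞) v = Gal(K̄/K_∞) ∩ D_v` vanishes (the strict condition of
the fine datum at `v`, conjugate `σ = 1`). [cite: Greenberg1989, §1 p. 98] -/
theorem resH1Hom_decompInToH_eq_zero_of_mem_fineSelmerInfty (hv : ((p : ℕ) : 𝓞 K) ∈ v.asIdeal)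
    {c : W.subgroupH1 p κ.kerSubgroup} (hc : c ∈ W.fineSelmerInfty κ) :
    resH1Hom (decompInToH κ.kerSubgroup v) (AddMonoidHom.id (geomPrimaryTorsion W p)) (fun _ _ => rfl) c
      = 0 := by
  have h1 := ((mem_strictSelmerGroupOver_iff c).1 hc).2.2 v hv 1
  rw [conjH1_one_holds, AddMonoidHom.id_apply, LocalDatum.mem_strictKer_iff] at h1
  -- `strictMap = H¹(grMk) ∘ res`
  have hfac : (fineData (geomPrimaryTorsion W p) p v hv).strictMap κ.kerSubgroup =
      (resH1Hom (ContinuousMonoidHom.id (decompIn κ.kerSubgroup v))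
        (fineLocalDatum (geomPrimaryTorsion W p) v).grMk (fun _ _ => rfl)).comp
      (resH1Hom (decompInToH κ.kerSubgroup v) (AddMonoidHom.id (geomPrimaryTorsion W p))
        (fun _ _ => rfl)) := by
    rw [LocalDatum.strictMap, resH1Hom_comp]
    exact resH1Hom_congr (ContinuousMonoidHom.ext fun _ => rfl) rfl _ _
  have h2 := (DFunLike.congr_fun hfac c).symm.trans h1
  exact resH1Hom_grMk_injective v κ.kerSubgroup (h2.trans (map_zero _).symm)

omit [Fact p.Prime] in
/-- Restriction to `decompIn H v` commutes with `E[p] ↪ E[p^∞]` on `H¹` (both composites are induced by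
the compatible pair `(decompIn H v → H, E[p] ↪ E[p^∞])`). [cite: GreenbergLNM1716, §3 Lemma 3.1] -/
theorem resH1Hom_decompInToH_torsionToPrimaryH1Sub (H : Subgroup (absoluteGaloisGroup K))
    (y : subgroupH1 H (geomTorsion W (p : ℤ))) :
    resH1Hom (decompInToH H v) (AddMonoidHom.id (geomPrimaryTorsion W p)) (fun _ _ => rfl)
        (W.torsionToPrimaryH1Sub p H y) =
      resH1Hom (ContinuousMonoidHom.id (decompIn H v))
        (AddSubgroup.inclusion (geomTorsion_le_geomPrimaryTorsion W p)) (fun _ _ => rfl)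
        (resH1Hom (decompInToH H v) (AddMonoidHom.id (geomTorsion W (p : ℤ))) (fun _ _ => rfl) y) := by
  rw [WeierstrassCurve.torsionToPrimaryH1Sub, ← AddMonoidHom.comp_apply, resH1Hom_comp,
    ← AddMonoidHom.comp_apply, resH1Hom_comp]
  exact DFunLike.congr_fun (resH1Hom_congr (ContinuousMonoidHom.ext fun _ => rfl)
    (AddMonoidHom.ext fun _ => rfl) _ _) y

/-- **A fine `y ∈ H¹(K_∞, E[p])` restricts into the local Kummer kernel at the place above `p`**: the
restriction of `y` to `decompIn Gal(K̄/K_∞) v` dies in `H¹(·, E[p^∞])`. [cite: Greenberg1989, §1 p. 98]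
[cite: GreenbergLNM1716, §3 Lemma 3.1] -/
theorem resH1Hom_decompInToH_mem_ker_of_mem_fineSelmerInfty (hv : ((p : ℕ) : 𝓞 K) ∈ v.asIdeal)
    {y : subgroupH1 κ.kerSubgroup (geomTorsion W (p : ℤ))}
    (hy : W.torsionToPrimaryH1Sub p κ.kerSubgroup y ∈ W.fineSelmerInfty κ) :
    resH1Hom (decompInToH κ.kerSubgroup v) (AddMonoidHom.id (geomTorsion W (p : ℤ))) (fun _ _ => rfl) y ∈
      (resH1Hom (ContinuousMonoidHom.id (decompIn κ.kerSubgroup v))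
        (AddSubgroup.inclusion (geomTorsion_le_geomPrimaryTorsion W p)) (fun _ _ => rfl) :
          subgroupH1 (decompIn κ.kerSubgroup v) (geomTorsion W (p : ℤ)) →+
            subgroupH1 (decompIn κ.kerSubgroup v) (geomPrimaryTorsion W p)).ker := by
  rw [AddMonoidHom.mem_ker, ← resH1Hom_decompInToH_torsionToPrimaryH1Sub]
  exact resH1Hom_decompInToH_eq_zero_of_mem_fineSelmerInfty W p κ v hv hy

/-- **The local Kummer kernel `B₁ = ker(H¹(decompIn H v, E[p]) → H¹(decompIn H v, E[p^∞]))` is finite**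
(transport of the tree's `finite_ker_torsionToPrimaryH1Sub` for the subgroup `H ⊓ D_v ≤ Γ_K` along the
tautological isomorphism `decompIn H v ≅ H ⊓ D_v`; `E(K̄)` is divisible, `zsmul_geomPoints_surjective_holds`).
[cite: GreenbergLNM1716, §3 Lemma 3.1] -/
theorem finite_ker_localTorsionToPrimary [W.IsElliptic] (H : Subgroup (absoluteGaloisGroup K)) :
    Set.Finite (((resH1Hom (ContinuousMonoidHom.id (decompIn H v))
        (AddSubgroup.inclusion (geomTorsion_le_geomPrimaryTorsion W p)) (fun _ _ => rfl) :
          subgroupH1 (decompIn H v) (geomTorsion W (p : ℤ)) →+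
            subgroupH1 (decompIn H v) (geomPrimaryTorsion W p)).ker : AddSubgroup _) :
        Set (subgroupH1 (decompIn H v) (geomTorsion W (p : ℤ)))) := by
  -- the tautological isomorphism `H ⊓ D_v ≅ decompIn H v` and its inverse
  let φ' : ↥(H ⊓ decomp v) →ₜ* decompIn H v :=
    { toFun := fun x => ⟨⟨(x : absoluteGaloisGroup K), (Subgroup.mem_inf.mp x.2).2⟩,
        (mem_decompIn_iff H v _).2 (Subgroup.mem_inf.mp x.2).1⟩
      map_one' := rfl
      map_mul' := fun _ _ => rfl
      continuous_toFun := (continuous_subtype_val.subtype_mk _).subtype_mk _ }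
  let e : decompIn H v →ₜ* ↥(H ⊓ decomp v) :=
    { toFun := fun x => ⟨((x : decomp v) : absoluteGaloisGroup K),
        Subgroup.mem_inf.mpr ⟨(mem_decompIn_iff H v x).1 x.2, x.1.2⟩⟩
      map_one' := rfl
      map_mul' := fun _ _ => rfl
      continuous_toFun := (continuous_subtype_val.comp continuous_subtype_val).subtype_mk _ }
  have hinv : ∀ x, φ' (e x) = x := fun x => Subtype.ext (Subtype.ext rfl)
  -- pull-back along `φ'` is injective on `H¹(·, E[p])`
  have hinj := resH1Hom_injective_of_leftInverse (M := geomTorsion W (p : ℤ)) φ' e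
    (fun _ _ => rfl) (fun _ _ => rfl) hinv
  -- and carries the local Kummer kernel into the kernel of `torsionToPrimaryH1Sub p (H ⊓ D_v)`
  refine Set.Finite.of_finite_image ?_ hinj.injOn
  refine (W.finite_ker_torsionToPrimaryH1Sub p (H := H ⊓ decomp v)
    W.zsmul_geomPoints_surjective_holds).subset ?_
  rintro _ ⟨c, hc, rfl⟩
  rw [SetLike.mem_coe, AddMonoidHom.mem_ker] at hc ⊢
  rw [WeierstrassCurve.torsionToPrimaryH1Sub, ← AddMonoidHom.comp_apply, resH1Hom_comp]
  have hnat : resH1Hom (φ'.comp (ContinuousMonoidHom.id ↥(H ⊓ decomp v)))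
      ((AddSubgroup.inclusion (geomTorsion_le_geomPrimaryTorsion W p)).comp
        (AddMonoidHom.id (geomTorsion W (p : ℤ)))) (fun x m => rfl) =
      (resH1Hom φ' (AddMonoidHom.id (geomPrimaryTorsion W p)) (fun _ _ => rfl)).comp
        (resH1Hom (ContinuousMonoidHom.id (decompIn H v))
          (AddSubgroup.inclusion (geomTorsion_le_geomPrimaryTorsion W p)) (fun _ _ => rfl)) := by
    rw [resH1Hom_comp]
    exact resH1Hom_congr (ContinuousMonoidHom.ext fun _ => rfl) (AddMonoidHom.ext fun _ => rfl) _ _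
  rw [hnat, AddMonoidHom.comp_apply, hc, map_zero]

end Fine

end Summit.BirchSwinnertonDyer.BirchSwinnertonDyer.Rank1Residual.SelmerDual

end
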